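import Summits.QuantumFields.YangMills.Theorems.BalabanUVNodesN08AlphaClassI
import Literature.MathematicalPhysics.QuantumFieldTheory.Balaban1983to89.B10Eq47VolumeSidak
import Summits.QuantumFields.Balaban3D.Proofs.Family

/-!
# Route «BalabanUVNodes», Track-A DAG node N08 = [Balaban1985UV3] — THE (α) CLAUSE, DATA ROW `h324a` ([B1] (3.24)(a), the small-field
# VOLUME of the box of (58)): DISCHARGED from the Gaussian identification of print's pin + the in-edge b9's covariance bound, by the tree's
# Šidák volume theorem `B10Eq47VolumeSidak.log_volume47_ge`

Cell `pub-ymgap`, seat `pub-ymgap-dag-n08-d` gen 3 (director-ym R134 row «CLASS-I in-edge conclusions at the (α) granularity of `RunAlpha` … discharge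
the species-OK interfaces»; census `HOME/pub-ymgap-dag-n08-b/N08-ALPHA-ROWS.md` 6a78a4e68c218d11 §1 row `h324a`: «III + I (b9 covariance bound) —
tree THEOREM for Gaussian data … closes BY NAME at a pin μ := multivariateGaussian 0 S, box := ballEvent»).  `bears_on: R4∕N08`; filed `--supports
stmt-QuantumFields-19903 --as helper`.  THEOREMS ONLY (def-free, sorry-free, standard axioms).

THE ROW.  `UVStability3DInputs.StepAlpha.h324a` (= gen 0's `StepDataRows.h324a`, a DATA row until now):
`∀ h U, |log μ_k(box_k(h))| ≤ Ca·(L^kg₀²)^{3+κ₀}·|T₁^{(k)}|` — [B1] (3.24) input (a) in the lane's smallness unit, the V = 0 half of the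
cumulant formula behind (24)∕(58): the Gaussian mass of the small-field characteristic function `χ = Π_{b∈B(Λ_{k+1})} χ({|A(b)| < p²(g_k)})`
((51) p. 268, after `A ↦ g_kA`; (18)∕(22) pp. 260–261 at the first step) costs at most the step's allowed error `O((L^kε)^{3+κ₀})|T₁^{(k)}|`
((47) p. 267).  The d = 3 lane (`pub-balaban3d`) consumes it as an (α) END hypothesis (`AlphaCumulant.cumulant58_*`); the tree PROVES it for
Gaussian data — `B10Eq47VolumeSidak.log_volume47_ge` (Šidák 1967 discharged, `GaussianSmallFieldSidak.sidakInequality_holds`) — under ONE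
clause `4d(𝔤)σ²(6 + 2κ₀) ≤ b₀⁴(1 + log g⁻¹)^{4p₀−1}` at the bare coupling; nobody had connected the two.
WHAT THIS FILE PROVES.
* §1 `h324a_of_gaussianPin`: the row FOLLOWS, for every step `k < K`, from (III, identification∕structure of print's pin) «the box mass IS the
  mass of the ball event `∩_b {|A(b)| < p²(g_k)}` under a centred Gaussian `N(0, S_k(h))` on `n_k(h)` real coordinates grouped in blocks of
  `≤ d(𝔤)`, with `4n_k(h) ≤ Ca·|T₁^{(k)}|`» + (I, in-edge b9 = [5] (3.155)–(3.156)) «`S_k(h)_{ii} ≤ σ²`» + the proviso «`4d(𝔤)σ²(6+2κ₀) ≤ b₀⁴`»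
  ((7) p. 257 «b₀ is a sufficiently large absolute constant» — the clause at the lane's NORMALISED bare coupling `g ↦ 1`, `ε ↦ g₀²`,
  `ScalesArithmetic.gk_eq_gRun_norm`); also `hbox_of_gaussianPin` (the row `hbox : μ(box) ≠ 0` from the same pin).
* §2 `proviso324a_of_le` — LOCATED for the lane: its recipe ⟦b₀ = b₀(N, L, M₁, …)⟧ (R-E2′, `Primitives.AlphaConsts.b₀`) does not mention b9's
  covariance constant σ², but gives `b₀² ≥ 224N` (`Family.prov_hb₂`), hence the proviso for EVERY `σ² ≤ 1792` when `d(𝔤) ≤ N²` (and `κ₀ < ½`):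
  numbers, so that the located dependence is explicit.
HONEST FRAMING: count-neutral; NOT a discharge of N08.  The Gaussian identification is what a NODE 00 pin of the expansion data `𝔖 k` to print's
objects instantiates ((58): «dμ is a Gaussian measure with a covariance …», p. 261 L30–33) — here a HYPOTHESIS about the free data; the covariance
bound is the in-edge b9's conclusion as a typed interface; the cumulant REMAINDER row `h324c` ((3.24)(c), the first missing estimate of Thm 2's
proof, census §2 (i)) is untouched.  d = 3 lattice gauge theory on finite tori as printed; nothing about d = 4, the continuum, OS axioms, a mass
gap or the Clay problem.
-/

noncomputable section

namespace Summit.QuantumFields.YangMills.Theorems.BalabanUVNodesN08Alpha324aVolume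

open MeasureTheory ProbabilityTheory
open scoped BigOperators
open Literature.MathematicalPhysics.QuantumFieldTheory.Balaban1983to89
open Literature.MathematicalPhysics.QuantumFieldTheory.Balaban1983to89.B10 (pFun gRun)
open Literature.MathematicalPhysics.QuantumFieldTheory.Balaban1983to89.B10Eq47Volume (ballEvent Clause)
open Literature.MathematicalPhysics.QuantumFieldTheory.Balaban1983to89.B10Eq47VolumeSidak (log_volume47_ge)
open Literature.MathematicalPhysics.QuantumFieldTheory.Balaban1985CMP102
open Literature.MathematicalPhysics.QuantumFieldTheory.Balaban1985CMP102.Setting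
open Summit.QuantumFields.Balaban3D.Carriers
open Summit.QuantumFields.Balaban3D.Proofs.Inputs
open Summit.QuantumFields.Balaban3D.Proofs.Primitives (AlphaConsts)
open Summit.QuantumFields.Balaban3D.Proofs.GroupModelLieC (lieC)
open Summit.QuantumFields.Balaban3D.Proofs.ScalesArithmetic (gk_eq_gRun_norm g0sq_pos norm_scale_le_one L_pos sites_nonneg)
open Summit.QuantumFields.Balaban3D.Proofs.Family (prov_hb₂)

variable {L : ℕ}

/-! ## §1 The row `h324a` from the Gaussian identification of the pin and b9's covariance bound -/

section Volume

variable {S : Scales L} {G : Type} [GaugeGroup G] [MeasurableSpace G] [HaarData G] (𝔊 : GroupModel G) (𝔠 : AlphaConsts L 𝔊.N)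
  (𝔖 : ∀ k, StepSeries S G ↥(lieC 𝔊) (nblkOf S 𝔠.lane.carrier k) k)

/-- The clause of `B10Eq47Volume` at the NORMALISED bare coupling `g = 1` IS the proviso `4d(𝔤)σ²(6 + 2κ₀) ≤ b₀⁴` (`log 1⁻¹ = 0`). [folklore] -/
theorem clause_one_iff {B E C' m : ℝ} : Clause B E C' m 1 ↔ C' * m ≤ B := by
  unfold Clause
  rw [inv_one, Real.log_one, add_zero, Real.one_rpow, mul_one]

/-- **THE DATA ROW `h324a` ([B1] (3.24)(a)) FROM THE GAUSSIAN IDENTIFICATION OF THE PIN + b9's COVARIANCE BOUND**, for a step `k < K`.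
Hypotheses, per history `h`: (identification, class III) the small-field box mass `μ_k(box_k(h))` of the data IS the `N(0, S_k(h))`-mass of the
ball event `∩_b {|A(b)| < p²(g_k)}` (`B10Eq47Volume.ballEvent`, blocks `fib h b` of `≤ d(𝔤)` among `n h` real coordinates — (51) p. 268 with
(58) «dμ_{C^{(k)}}»), `S_k(h)` positive semidefinite, and the count `4·n h ≤ Ca·|T₁^{(k)}|` (`|B(Λ_{k+1})*|·d(𝔤) = O(1)|T₁^{(k)}|`); (in-edge
b9 = [5] (3.155)–(3.156), class I) the diagonal covariance bound `S_k(h)_{ii} ≤ σ²`; (proviso, (7) «b₀ sufficiently large»)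
`4d(𝔤)σ²(6 + 2κ₀) ≤ b₀⁴`.  Conclusion: the row verbatim, `|log μ_k(box_k(h))| ≤ Ca·(L^kg₀²)^{3+κ₀}·|T₁^{(k)}|` — by
`B10Eq47VolumeSidak.log_volume47_ge` at the normalised parametrisation `g ↦ 1`, `ε ↦ g₀²` (`ScalesArithmetic.gk_eq_gRun_norm`,
`norm_scale_le_one`) for the lower half, `μ ≤ 1` for the upper half. [cite: Balaban1985UV3, (51) p.268 + (47) p.267 + p.262 L1–3; Balaban1982Higgs1, (3.24) p.616] -/
theorem h324a_of_gaussianPin (k : ℕ) (hk : k + 1 ≤ S.K) {σ2 : ℝ} (hσ : 0 < σ2) {dG : ℕ} (hdG : 0 < dG)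
    (hprov : 4 * (dG : ℝ) * σ2 * (6 + 2 * 𝔠.κ₀) ≤ 𝔠.b₀ ^ 4)
    (n : Hist S.P (k + 1) → ℕ) (Sm : (h : Hist S.P (k + 1)) → Matrix (Fin (n h)) (Fin (n h)) ℝ)
    (m : Hist S.P (k + 1) → ℕ) (fib : (h : Hist S.P (k + 1)) → Fin (m h) → Finset (Fin (n h)))
    (hpsd : ∀ h, (Sm h).PosSemidef) (hfib : ∀ h b, (fib h b).card ≤ dG) (hcount : ∀ h, 4 * (n h : ℝ) ≤ 𝔠.Ca * S.sites k)
    (hcov : ∀ h i, Sm h i i ≤ σ2)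
    (hId : ∀ h, (𝔖 k).μ.real ((𝔖 k).box h) =
      (multivariateGaussian 0 (Sm h)).real (ballEvent (fib h) (pFun 𝔠.b₀ 𝔠.p₀ (S.gk k) ^ 2))) :
    ∀ (h : Hist S.P (k + 1)) (U : GaugeField S.P (k + 1) G),
      |Real.log ((𝔖 k).μ.real ((𝔖 k).box h))| ≤ 𝔠.Ca * ((L : ℝ) ^ k * S.g0sq) ^ (3 + 𝔠.κ₀) * S.sites k := by
  intro h _U
  have hκ : 0 ≤ 𝔠.κ₀ := 𝔠.κ₀_pos.le
  have hp₀ : 1 ≤ 𝔠.p₀ := by linarith [𝔠.two_lt_p₀]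
  have ht1 : (L : ℝ) ^ k * S.g0sq ≤ 1 := norm_scale_le_one S S.gK_le_one k (by omega)
  have hunit : 0 ≤ ((L : ℝ) ^ k * S.g0sq) ^ (3 + 𝔠.κ₀) :=
    Real.rpow_nonneg (mul_nonneg (pow_nonneg (L_pos S).le k) (g0sq_pos S).le) _
  have hγ : Clause (𝔠.b₀ ^ 4) (4 * 𝔠.p₀) (4 * dG * σ2) (6 + 2 * 𝔠.κ₀) 1 := clause_one_iff.2 hprov
  -- the lower half: Šidák's volume theorem at the normalised parametrisation
  have hlow := log_volume47_ge (hpsd h) hσ (hcov h) (fib h) hdG (hfib h) 𝔠.b₀_pos hp₀ one_pos le_rfl (L_pos S) (g0sq_pos S)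
    ht1 hκ hγ
  rw [← gk_eq_gRun_norm, ← hId h] at hlow
  -- the upper half: a probability
  have hle1 : (𝔖 k).μ.real ((𝔖 k).box h) ≤ 1 := by rw [hId h]; exact measureReal_le_one
  have hup : Real.log ((𝔖 k).μ.real ((𝔖 k).box h)) ≤ 0 := Real.log_nonpos measureReal_nonneg hle1
  have hn : 4 * ((L : ℝ) ^ k * S.g0sq) ^ (3 + 𝔠.κ₀) * (n h : ℝ) ≤ 𝔠.Ca * ((L : ℝ) ^ k * S.g0sq) ^ (3 + 𝔠.κ₀) * S.sites k := by
    calc 4 * ((L : ℝ) ^ k * S.g0sq) ^ (3 + 𝔠.κ₀) * (n h : ℝ) = ((L : ℝ) ^ k * S.g0sq) ^ (3 + 𝔠.κ₀) * (4 * (n h : ℝ)) := by ring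
      _ ≤ ((L : ℝ) ^ k * S.g0sq) ^ (3 + 𝔠.κ₀) * (𝔠.Ca * S.sites k) := mul_le_mul_of_nonneg_left (hcount h) hunit
      _ = 𝔠.Ca * ((L : ℝ) ^ k * S.g0sq) ^ (3 + 𝔠.κ₀) * S.sites k := by ring
  rw [abs_le]
  constructor <;> linarith

/-- **THE ROW `hbox` («the small-field box has positive mass») FROM THE SAME IDENTIFICATION**: the `N(0, S_k(h))`-mass of the ball event is at
least `exp(−4(L^kg₀²)^{3+κ₀}·n_k(h)) > 0`. [cite: Balaban1985UV3, (51) p.268 + (58) p.270] -/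
theorem hbox_of_gaussianPin (k : ℕ) (hk : k + 1 ≤ S.K) {σ2 : ℝ} (hσ : 0 < σ2) {dG : ℕ} (hdG : 0 < dG)
    (hprov : 4 * (dG : ℝ) * σ2 * (6 + 2 * 𝔠.κ₀) ≤ 𝔠.b₀ ^ 4)
    (n : Hist S.P (k + 1) → ℕ) (Sm : (h : Hist S.P (k + 1)) → Matrix (Fin (n h)) (Fin (n h)) ℝ)
    (m : Hist S.P (k + 1) → ℕ) (fib : (h : Hist S.P (k + 1)) → Fin (m h) → Finset (Fin (n h)))
    (hpsd : ∀ h, (Sm h).PosSemidef) (hfib : ∀ h b, (fib h b).card ≤ dG) (hcov : ∀ h i, Sm h i i ≤ σ2)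
    (hId : ∀ h, (𝔖 k).μ.real ((𝔖 k).box h) =
      (multivariateGaussian 0 (Sm h)).real (ballEvent (fib h) (pFun 𝔠.b₀ 𝔠.p₀ (S.gk k) ^ 2))) :
    ∀ h : Hist S.P (k + 1), (𝔖 k).μ ((𝔖 k).box h) ≠ 0 := by
  intro h
  have hκ : 0 ≤ 𝔠.κ₀ := 𝔠.κ₀_pos.le
  have hp₀ : 1 ≤ 𝔠.p₀ := by linarith [𝔠.two_lt_p₀]
  have ht1 : (L : ℝ) ^ k * S.g0sq ≤ 1 := norm_scale_le_one S S.gK_le_one k (by omega)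
  have hγ : Clause (𝔠.b₀ ^ 4) (4 * 𝔠.p₀) (4 * dG * σ2) (6 + 2 * 𝔠.κ₀) 1 := clause_one_iff.2 hprov
  have hvol := B10Eq47VolumeSidak.volume47_real_ge (hpsd h) hσ (hcov h) (fib h) hdG (hfib h) 𝔠.b₀_pos hp₀ one_pos le_rfl
    (L_pos S) (g0sq_pos S) ht1 hκ hγ
  rw [← gk_eq_gRun_norm, ← hId h] at hvol
  have hpos : 0 < (𝔖 k).μ.real ((𝔖 k).box h) := lt_of_lt_of_le (Real.exp_pos _) hvol
  rw [measureReal_def] at hpos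
  exact (ENNReal.toReal_pos_iff.1 hpos).1.ne'

end Volume

/-! ## §2 The proviso «b₀ sufficiently large» against the lane's recipe for `b₀` (located, with numbers) -/

section Proviso

variable {N : ℕ} (𝔠 : AlphaConsts L N)

/-- **THE PROVISO FROM THE LANE'S `b₀` FOR EVERY COVARIANCE CONSTANT `σ² ≤ 1792`** (located dependence made explicit): the lane's recipe gives
`b₀² ≥ 224·N` (`Family.prov_hb₂`: `56 ≤ b₀²∕(4N)`), so `b₀⁴ ≥ 50176·N²`; with `κ₀ < ½` and `d(𝔤) ≤ N²` the proviso `4d(𝔤)σ²(6+2κ₀) ≤ b₀⁴` holds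
as soon as `28σ² ≤ 50176`, i.e. `σ² ≤ 1792`.  For b9's O(1) beyond that, R-E2′'s recipe ⟦b₀ = b₀(N, L, M₁, …)⟧ must take σ² as an argument.
[cite: Balaban1985UV3, (7) p.257 «b₀ is a sufficiently large absolute constant»] -/
theorem proviso324a_of_le (hN : 0 < N) {dG : ℕ} (hdG : (dG : ℝ) ≤ (N : ℝ) ^ 2) {σ2 : ℝ} (hσ0 : 0 ≤ σ2) (hσ : σ2 ≤ 1792) :
    4 * (dG : ℝ) * σ2 * (6 + 2 * 𝔠.κ₀) ≤ 𝔠.b₀ ^ 4 := by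
  have hN1 : (1 : ℝ) ≤ N := by exact_mod_cast hN
  have hκ := 𝔠.κ₀_lt_half
  have hκ0 := 𝔠.κ₀_pos
  have hb : 56 ≤ 1 / (4 * (N : ℝ)) * 𝔠.b₀ ^ 2 := prov_hb₂ 𝔠 hN
  have hb2 : 224 * (N : ℝ) ≤ 𝔠.b₀ ^ 2 := by
    have h4N : (0 : ℝ) < 4 * N := by positivity
    have := (le_div_iff₀' h4N).1 (by simpa [one_div, div_eq_inv_mul] using hb)
    linarith
  have hb4 : (224 * (N : ℝ)) ^ 2 ≤ (𝔠.b₀ ^ 2) ^ 2 := pow_le_pow_left₀ (by positivity) hb2 2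
  have hdG0 : (0 : ℝ) ≤ dG := Nat.cast_nonneg _
  calc 4 * (dG : ℝ) * σ2 * (6 + 2 * 𝔠.κ₀) ≤ 4 * (N : ℝ) ^ 2 * 1792 * 7 := by
        have h7 : 6 + 2 * 𝔠.κ₀ ≤ 7 := by linarith
        have h1 : 4 * (dG : ℝ) * σ2 ≤ 4 * (N : ℝ) ^ 2 * 1792 := by nlinarith
        calc 4 * (dG : ℝ) * σ2 * (6 + 2 * 𝔠.κ₀) ≤ 4 * (dG : ℝ) * σ2 * 7 :=
              mul_le_mul_of_nonneg_left h7 (by positivity)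
          _ ≤ 4 * (N : ℝ) ^ 2 * 1792 * 7 := by nlinarith
    _ = (224 * (N : ℝ)) ^ 2 := by ring
    _ ≤ (𝔠.b₀ ^ 2) ^ 2 := hb4
    _ = 𝔠.b₀ ^ 4 := by ring

end Proviso

end Summit.QuantumFields.YangMills.Theorems.BalabanUVNodesN08Alpha324aVolume

end
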